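import Summits.AtomisticToContinuum.Crystallization.Theorems.ChartedZeroExcessLayeredLatticeLiouvilleZZZYRCXM
import Summits.AtomisticToContinuum.Crystallization.Theorems.ChartedZeroExcessLayeredLatticeLiouvilleZZZYRCXRK

/-!
# ChartedZeroExcessLayeredLatticeLiouville · ZZZYRCXRM — THE θ⁰ OUT-OF-WINDOW COUNT: FOLD-TO-COUNT AND THE SIGNED READING OF `u9O` (§7)
(decomp-a2c hand-1 g55, STAGED with RCXRK/RCXRL/RCXRS for g56; critic r1871 (D) «A1 = the θ_out kernel delta of record»)

The out-count `countWinsO win wlo whi amX GB lo hi ym` (RCXRK §5) scans the in-plane box offsets `(a, b)`, `a, b < 2GB + 1`, at ONE far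
(shifted) layer `ym` and counts those passing the ∃-letter window test `someInWindow`.  §7 turns the nested fold into a count:
`boxPairs GB` (the scanned offsets as one list, `mem_boxPairs`), the generic `foldl_count_eq`, ★ `countWinsO_eq`
(`countWinsO … = ((boxPairs GB).filter someInWindow…).length`), `card_filter_boxPairs_le` (pigeonhole currency, cf. RCXN `card_windowSet_le`),
and ★ `u9O_eq`: the program's ℕ `u9O` IS the signed `n9` of the far index site `(a − GB, b − GB, ym − amX)` with the letter difference
`regO(ym) − regO(amX)` (RCXM `offset_n9_general`).  These are the two facts the Δm-block pigeonhole of the out-slabs (g56: the out analogue of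
RCXR `residue_completeW`) consumes.  Imports RCXM + RCXRK; Mathlib-light; 0 sorry.  All `[folklore]`.
-/

namespace Summit.AtomisticToContinuum.Crystallization.Theorems.ChartedZeroExcessLayeredLatticeLiouville.ThetaKernel

/-! ## §7 the out-count: fold-to-count and the signed reading of `u9O` -/

/-- the scanned in-plane box offsets `(a, b)`, `a, b < 2GB + 1`, as ONE list. -/
def boxPairs (GB : ℕ) : List (ℕ × ℕ) := (List.range (2 * GB + 1)).flatMap fun a => (List.range (2 * GB + 1)).map fun b => (a, b)

/-- membership in the scanned box. [folklore] -/
theorem mem_boxPairs {GB a b : ℕ} : (a, b) ∈ boxPairs GB ↔ a < 2 * GB + 1 ∧ b < 2 * GB + 1 := by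
  simp only [boxPairs, List.mem_flatMap, List.mem_map, List.mem_range, Prod.mk.injEq]
  constructor
  · rintro ⟨a', ha', b', hb', rfl, rfl⟩; exact ⟨ha', hb'⟩
  · rintro ⟨ha, hb⟩; exact ⟨a, ha, b, hb, rfl, rfl⟩

/-- generic: a counting fold counts. [folklore] -/
theorem foldl_count_eq {α : Type*} (p : α → Bool) : ∀ (l : List α) (init : ℕ),
    l.foldl (fun n x => bif p x then n + 1 else n) init = init + (l.filter p).length
  | [], init => by simp
  | x :: rest, init => by
    rw [List.foldl_cons, List.filter_cons, foldl_count_eq p rest]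
    cases p x
    · simp
    · simp only [cond_true, ite_true, List.length_cons]; omega

/-- ★ THE OUT-COUNT COUNTS: `countWinsO` is the number of box offsets `(a, b)` at the far layer `ym` passing the ∃-letter window test. [folklore] -/
theorem countWinsO_eq (win : List ℕ) (wlo whi amX GB lo hi ym : ℕ) :
    countWinsO win wlo whi amX GB lo hi ym = ((boxPairs GB).filter fun ab => someInWindow win wlo whi amX GB lo hi ab.1 ab.2 ym).length := by
  unfold countWinsO boxPairs
  have key : ∀ (l : List ℕ) (init : ℕ),
      l.foldl (fun n a => (List.range (2 * GB + 1)).foldl (fun n b => bif someInWindow win wlo whi amX GB lo hi a b ym then n + 1 else n) n) init =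
        init + ((l.flatMap fun a => (List.range (2 * GB + 1)).map fun b => (a, b)).filter
          fun ab => someInWindow win wlo whi amX GB lo hi ab.1 ab.2 ym).length := by
    intro l
    induction l with
    | nil => intro init; simp
    | cons a rest ih =>
      intro init
      rw [List.foldl_cons, foldl_count_eq, ih, List.flatMap_cons, List.filter_append, List.length_append, List.filter_map,
        List.length_map]
      have : (List.filter ((fun ab : ℕ × ℕ => someInWindow win wlo whi amX GB lo hi ab.1 ab.2 ym) ∘ fun b => (a, b))
          (List.range (2 * GB + 1))).length =
          (List.filter (fun b => someInWindow win wlo whi amX GB lo hi a b ym) (List.range (2 * GB + 1))).length := rfl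
      rw [this]; omega
  rw [key]; simp

/-- the block's site set is no larger than the out-count (pigeonhole currency, cf. RCXN `card_windowSet_le`). [folklore] -/
theorem card_filter_boxPairs_le (win : List ℕ) (wlo whi amX GB lo hi ym : ℕ) :
    ((boxPairs GB).filter fun ab => someInWindow win wlo whi amX GB lo hi ab.1 ab.2 ym).toFinset.card ≤
      countWinsO win wlo whi amX GB lo hi ym := by
  rw [countWinsO_eq]; exact List.toFinset_card_le _

/-- ★ THE OUT-COUNT'S `n9` IS THE SIGNED `n9` of the far index site `(a − GB, b − GB)` at shifted layer `ym` from the shifted base `amX`, with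
letters by `regO` (window letter at the base — the base lies in the window — and at `ym` if in the window, else the trial `rY`). [folklore] -/
theorem u9O_eq (win : List ℕ) (wlo whi amX GB a b ym rY : ℕ) (hX : amX < 1201)
    (hra : regO win wlo whi ym rY ym rY rY amX ≤ 2) :
    ((u9O win wlo whi amX GB a b ym rY : ℕ) : ℤ) =
      let d : ℤ := (regO win wlo whi ym rY ym rY rY ym : ℤ) - regO win wlo whi ym rY ym rY rY amX
      (3 * ((a : ℤ) - GB) + d) * (3 * ((a : ℤ) - GB) + d) + (3 * ((a : ℤ) - GB) + d) * (3 * ((b : ℤ) - GB) + d) +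
        (3 * ((b : ℤ) - GB) + d) * (3 * ((b : ℤ) - GB) + d) + 6 * ((ym : ℤ) - amX) * ((ym : ℤ) - amX) := by
  unfold u9O
  simp only
  set ra := regO win wlo whi ym rY ym rY rY amX
  set rb := regO win wlo whi ym rY ym rY rY ym
  have hx0 : ((3 * a + 3 + rb - ra : ℕ) : ℤ) = (3 * ((a : ℤ) - GB) + ((rb : ℤ) - ra)) + ((3 * GB + 3 : ℕ) : ℤ) := by
    have hle : ra ≤ 3 * a + 3 + rb := by omega
    push_cast [Nat.cast_sub hle]; ring
  have hx1 : ((3 * b + 3 + rb - ra : ℕ) : ℤ) = (3 * ((b : ℤ) - GB) + ((rb : ℤ) - ra)) + ((3 * GB + 3 : ℕ) : ℤ) := by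
    have hle : ra ≤ 3 * b + 3 + rb := by omega
    push_cast [Nat.cast_sub hle]; ring
  have hxm : ((ym + 1201 - amX : ℕ) : ℤ) = ((ym : ℤ) - amX) + ((1201 : ℕ) : ℤ) := by
    have hle : amX ≤ ym + 1201 := by omega
    push_cast [Nat.cast_sub hle]; ring
  have h := offset_n9_general (3 * a + 3 + rb - ra) (3 * b + 3 + rb - ra) (ym + 1201 - amX) (3 * GB + 3) 1201 _ _ _ hx0 hx1 hxm
  rw [← h]

end Summit.AtomisticToContinuum.Crystallization.Theorems.ChartedZeroExcessLayeredLatticeLiouville.ThetaKernel
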